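import Literature.AlgebraicTopology.SingularHomology.ProductWithContractible
import Literature.AlgebraicTopology.SingularHomology.RelativeCochainsExcision
import Literature.AlgebraicTopology.SingularHomology.RelativeCochainsMaps
import HarnessLib

/-!
# The cohomology of `U × Y` for `Y` the union of two contractible open pieces

A. Hatcher, *Algebraic Topology* (2002), §3.1 pp. 199–201 (the long exact sequence of a pair,
excision, homotopy invariance for singular cohomology), organised as the standard computation of
the cohomology of a product with a suspension-like space: let `Y = Y₁ ∪ Y₂` with `Y₁`, `Y₂` OPEN
and (as subspaces) CONTRACTIBLE, and let `U` be any space. Then, for every coefficient module and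
naturally in `U`,

* the restriction `Hⁿ(U × Y) → Hⁿ(U × Y₁)` is split (`U × Y₁ ≃ U`, `ProductWithContractible`),
  so `Hⁿ(U × Y, U × Y₁) → Hⁿ(U × Y)` is injective (`toAbsolute_vert_injective`) and
  `Hⁿ(U × Y) = pr₁^* Hⁿ(U) ⊕ Hⁿ(U × Y, U × Y₁)` (`coprod_vert_bijective`);
* by excision `Hⁿ(U × Y, U × Y₁) ≅ Hⁿ(U × Y₂, U × (Y₁ ∩ Y₂))` (`isIso_excMap`);
* in the pair `(U × Y₂, U × (Y₁ ∩ Y₂))` the restriction from `U × Y₂ ≃ U` is injective as soon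
  as `Y₁ ∩ Y₂ ≠ ∅` (a slice splits it), so `Hⁿ(U × Y₂, U × Z) → Hⁿ(U × Y₂)` vanishes and the
  coboundary `δ : Hⁱ(U × Z) → Hⁱ⁺¹(U × Y₂, U × Z)`, `Z = Y₁ ∩ Y₂`, is SURJECTIVE with kernel the
  classes pulled back from `U` (`δ_inter_surjective`, `δ_inter_eq_zero_iff`);
* all in all (`κ = toAbsolute ∘ exc⁻¹ ∘ δ : Hⁱ(U × Z) → Hⁱ⁺¹(U × Y)`): every class of
  `Hⁱ⁺¹(U × Y)` is `pr₁^* y + κ a` with `y` unique (`= s^* x`) and `a` unique modulo `pr₁^* Hⁱ(U)`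
  (`exists_eq_map_fst_add_κ`, `map_fst_add_κ_eq_zero_iff`, `κ_eq_zero_iff`), `H⁰(U × Y) = pr₁^* H⁰(U)`
  (`map_fst_bijective_zero`), and `κ` is natural in `U` (`map_prodMap_κ`).

With `Y = ℂ^×` (two slit planes, `Z` = two half planes) this gives `Hⁿ(U × ℂ^×) ≅ Hⁿ(U) ⊕ Hⁿ⁻¹(U)`,
and with `Y = ℂP¹` (two affine charts, `Z ≅ ℂ^×`) `Hⁿ(U × ℂP¹) ≅ Hⁿ(U) ⊕ Hⁿ⁻²(U)` — the cohomology
of a trivialised `ℂP¹`-bundle, the local input of the construction of the first Chern class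
(sequel files). Everything is proved; no named facts. The subsets are `vert U Y₁ = U × Y₁ ⊆ U × Y`
(`Prod.snd ⁻¹' Y₁`) and, inside the subspace `↥(vert U Y₂)`, `inter U Y₁ Y₂ = val ⁻¹' (vert U Y₁)`
(homeomorphic to `U × ↥(Y₁ ∩ Y₂)`, `interHomeomorph`).

## References

* A. Hatcher, *Algebraic Topology*, CUP 2002, §3.1 pp. 199–201; §2.1 pp. 117–119 (split exact
  sequences of pairs with a retraction), Thm. 2.20 (excision). [HatcherAT2002]
-/

noncomputable section

open CategoryTheory Set

universe u v

namespace Literature.AlgebraicTopology.SingularHomology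

variable {U U' : Type u} {Y : Type u} [TopologicalSpace U] [TopologicalSpace U'] [TopologicalSpace Y]

/-! ### Vertical subsets of a product and their slices -/

variable (U) in
/-- `U × Y₁` as a subset of `U × Y`. [folklore] -/
abbrev vert (Y₁ : Set Y) : Set (U × Y) := Prod.snd ⁻¹' Y₁

/-- `U × Y₁` is open for `Y₁` open. [folklore] -/
theorem isOpen_vert {Y₁ : Set Y} (h : IsOpen Y₁) : IsOpen (vert U Y₁) := h.preimage continuous_snd

variable (U) in
/-- `U × (Y₁ ∩ Y₂)` as a subset of the subspace `↥(U × Y₂)`. [folklore] -/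
abbrev inter (Y₁ Y₂ : Set Y) : Set ↥(vert U Y₂) := Subtype.val ⁻¹' vert U Y₁

variable (U) in
/-- `↥(U × Y₁) ≃ₜ U × ↥Y₁`. [folklore] -/
def vertHomeomorph (Y₁ : Set Y) : ↥(vert U Y₁) ≃ₜ U × ↥Y₁ where
  toFun p := (p.1.1, ⟨p.1.2, p.2⟩)
  invFun q := ⟨(q.1, (q.2 : Y)), q.2.2⟩
  left_inv _ := rfl
  right_inv _ := rfl
  continuous_toFun := (continuous_fst.comp continuous_subtype_val).prodMk
    ((continuous_snd.comp continuous_subtype_val).subtype_mk _)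
  continuous_invFun := (continuous_fst.prodMk (continuous_subtype_val.comp continuous_snd)).subtype_mk _

variable (U) in
/-- `↥(U × (Y₁ ∩ Y₂)) ≃ₜ U × ↥(Y₁ ∩ Y₂)` (the former as a subspace of `↥(U × Y₂)`). [folklore] -/
def interHomeomorph (Y₁ Y₂ : Set Y) : ↥(inter U Y₁ Y₂) ≃ₜ U × ↥(Y₁ ∩ Y₂) where
  toFun p := (p.1.1.1, ⟨p.1.1.2, p.2, p.1.2⟩)
  invFun q := ⟨⟨(q.1, (q.2 : Y)), q.2.2.2⟩, q.2.2.1⟩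
  left_inv _ := rfl
  right_inv _ := rfl
  continuous_toFun :=
    ((continuous_fst.comp continuous_subtype_val).comp continuous_subtype_val).prodMk
      (((continuous_snd.comp continuous_subtype_val).comp continuous_subtype_val).subtype_mk _)
  continuous_invFun :=
    ((continuous_fst.prodMk (continuous_subtype_val.comp continuous_snd)).subtype_mk _).subtype_mk _

variable (U) in
/-- The slice `u ↦ (u, y₁)` into `↥(U × Y₁)`. [folklore] -/
def secVert {Y₁ : Set Y} {y₁ : Y} (hy₁ : y₁ ∈ Y₁) : C(U, ↥(vert U Y₁)) where
  toFun u := ⟨(u, y₁), hy₁⟩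
  continuous_toFun := (continuous_id.prodMk continuous_const).subtype_mk _

variable (U) in
/-- The projection `↥(U × Y₁) → U`. [folklore] -/
def fstVert (Y₁ : Set Y) : C(↥(vert U Y₁), U) where
  toFun p := p.1.1
  continuous_toFun := continuous_fst.comp continuous_subtype_val

variable (U) in
/-- The slice `u ↦ (u, z₀)` into `↥(U × (Y₁ ∩ Y₂))`. [folklore] -/
def secInter {Y₁ Y₂ : Set Y} {z₀ : Y} (hz₀ : z₀ ∈ Y₁ ∩ Y₂) : C(U, ↥(inter U Y₁ Y₂)) where
  toFun u := ⟨⟨(u, z₀), hz₀.2⟩, hz₀.1⟩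
  continuous_toFun := ((continuous_id.prodMk continuous_const).subtype_mk _).subtype_mk _

variable (U) in
/-- The projection `↥(U × (Y₁ ∩ Y₂)) → U`. [folklore] -/
def fstInter (Y₁ Y₂ : Set Y) : C(↥(inter U Y₁ Y₂), U) where
  toFun p := p.1.1.1
  continuous_toFun := (continuous_fst.comp continuous_subtype_val).comp continuous_subtype_val

/-- `pr ∘ s = 𝟙`. [folklore] -/
theorem fstVert_comp_secVert {Y₁ : Set Y} {y₁ : Y} (hy₁ : y₁ ∈ Y₁) :
    (fstVert U Y₁).comp (secVert U hy₁) = ContinuousMap.id U := rfl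

/-- The slice into `U × Y₁`, followed by the inclusion, is the slice of `U × Y`. [folklore] -/
theorem subsetIncl_comp_secVert {Y₁ : Set Y} {y₁ : Y} (hy₁ : y₁ ∈ Y₁) :
    (subsetIncl (vert U Y₁)).comp (secVert U hy₁) = sliceAt y₁ := rfl

/-- `pr₁` restricted to `U × Y₁`. [folklore] -/
theorem fst_comp_subsetIncl_vert (Y₁ : Set Y) :
    (ContinuousMap.fst : C(U × Y, U)).comp (subsetIncl (vert U Y₁)) = fstVert U Y₁ := rfl

/-- `U × Y₁ → U` factors through `↥(U × Y₁) ≃ₜ U × ↥Y₁`. [folklore] -/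
theorem fstVert_eq_comp (Y₁ : Set Y) :
    fstVert U Y₁ = (ContinuousMap.fst : C(U × ↥Y₁, U)).comp (vertHomeomorph U Y₁ : C(↥(vert U Y₁), U × ↥Y₁)) :=
  rfl

/-- The slice into `U × Z`, followed by the inclusion, is the slice of `U × Y₂`. [folklore] -/
theorem subsetIncl_comp_secInter {Y₁ Y₂ : Set Y} {z₀ : Y} (hz₀ : z₀ ∈ Y₁ ∩ Y₂) :
    (subsetIncl (inter U Y₁ Y₂)).comp (secInter U hz₀) = secVert U hz₀.2 := rfl

/-- `U × Y₂ → U` restricted to `U × Z`. [folklore] -/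
theorem fstVert_comp_subsetIncl_inter (Y₁ Y₂ : Set Y) :
    (fstVert U Y₂).comp (subsetIncl (inter U Y₁ Y₂)) = fstInter U Y₁ Y₂ := rfl

/-- `U × Z → U` factors through `↥(U × Z) ≃ₜ U × ↥Z`. [folklore] -/
theorem fstInter_eq_comp (Y₁ Y₂ : Set Y) :
    fstInter U Y₁ Y₂ =
      (ContinuousMap.fst : C(U × ↥(Y₁ ∩ Y₂), U)).comp (interHomeomorph U Y₁ Y₂ : C(↥(inter U Y₁ Y₂), _)) :=
  rfl

/-- A left inverse of a bijection is a bijection. [folklore] -/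
private theorem bijective_of_leftInverse {α β : Type*} {f : α → β} {g : β → α}
    (hf : Function.Bijective f) (hgf : Function.LeftInverse g f) : Function.Bijective g :=
  ⟨fun x y hxy => by
    obtain ⟨a, rfl⟩ := hf.2 x
    obtain ⟨b, rfl⟩ := hf.2 y
    rw [hgf a, hgf b] at hxy
    rw [hxy], hgf.surjective⟩

variable (R : Type v) [CommRing R] (M : Type v) [AddCommGroup M] [Module R M]

/-! ### Generalities on the pair `(X, A)`: `Hⁿ(X, A) → Hⁿ(X) → Hⁿ(A)` composes to zero; degree `0` -/

section Pair

variable {X : Type u} [TopologicalSpace X] (A : Set X)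

/-- `Hⁿ(X, A) → Hⁿ(X) → Hⁿ(A)` is zero. [cite: HatcherAT2002, §3.1 p. 200] -/
theorem toAbsolute_comp_map_subsetIncl (n : ℕ) :
    relSingularCohomology.toAbsolute R M X A n ≫ singularCohomology.map R M (subsetIncl A) n = 0 := by
  change HomologicalComplex.homologyMap (relShortComplex R M A).f n ≫
    HomologicalComplex.homologyMap (relShortComplex R M A).g n = 0
  rw [← HomologicalComplex.homologyMap_comp, (relShortComplex R M A).zero,
    HomologicalComplex.homologyMap_zero]

/-- `Hⁿ(X) → Hⁿ(A) → Hⁿ⁺¹(X, A)` is zero. [cite: HatcherAT2002, §3.1 p. 200] -/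
theorem map_subsetIncl_comp_δ (i j : ℕ) (hij : i + 1 = j) :
    singularCohomology.map R M (subsetIncl A) i ≫ relSingularCohomology.δ R M X A i j hij = 0 :=
  (relShortComplex_shortExact R M A).comp_δ i j hij

/-- **In degree `0`, `H⁰(X, A) → H⁰(X)` is injective** (no coboundaries). [cite: HatcherAT2002, §3.1 p. 199] -/
theorem toAbsolute_zero_injective :
    Function.Injective (relSingularCohomology.toAbsolute R M X A 0) := by
  haveI : Mono ((relCochainComplex.ι R M A).f 0) :=
    (ModuleCat.mono_iff_injective _).2 relCochainComplex.ι_f_injective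
  haveI := HomologicalComplex.mono_homologyMap_of_mono_of_not_rel (relCochainComplex.ι R M A) 0
    (fun i (h : i + 1 = 0) => Nat.succ_ne_zero i h)
  exact (ModuleCat.mono_iff_injective _).1 this

end Pair

/-! ### Splitting off `Hⁿ(U)`: the pair `(U × Y, U × Y₁)` with `Y₁` contractible -/

section SplitOff

variable {Y₁ : Set Y} [ContractibleSpace ↥Y₁]

/-- `(U × Y₁ → U)^*` is bijective for contractible `Y₁`. [cite: HatcherAT2002, §3.1 p. 201] -/
theorem map_fstVert_bijective (n : ℕ) :
    Function.Bijective (singularCohomology.map R M (fstVert U Y₁) n) := by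
  rw [fstVert_eq_comp, singularCohomology.map_comp]
  exact (singularCohomology.mapIso R M (vertHomeomorph U Y₁) n).toLinearEquiv.bijective.comp
    (map_fst_bijective R M n)

/-- Every slice `u ↦ (u, y₁)` of `U × Y₁` induces a bijection, inverse to `(U × Y₁ → U)^*`.
[cite: HatcherAT2002, §3.1 p. 201] -/
theorem map_secVert_bijective {y₁ : Y} (hy₁ : y₁ ∈ Y₁) (n : ℕ) :
    Function.Bijective (singularCohomology.map R M (secVert U hy₁) n) := by
  refine bijective_of_leftInverse (map_fstVert_bijective R M n) fun b => ?_
  rw [← ModuleCat.comp_apply, ← singularCohomology.map_comp, fstVert_comp_secVert,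
    singularCohomology.map_id, ModuleCat.id_apply]

/-- `(U × Y₁ → U)^* ∘ s^* = 𝟙` on `Hⁿ(U × Y₁)`. [cite: HatcherAT2002, §3.1 p. 201] -/
theorem map_fstVert_map_secVert {y₁ : Y} (hy₁ : y₁ ∈ Y₁) (n : ℕ) (a : singularCohomology R M ↥(vert U Y₁) n) :
    singularCohomology.map R M (fstVert U Y₁) n (singularCohomology.map R M (secVert U hy₁) n a) = a := by
  obtain ⟨b, rfl⟩ := (map_fstVert_bijective R M (U := U) (Y₁ := Y₁) n).2 a
  rw [← ModuleCat.comp_apply (singularCohomology.map R M (fstVert U Y₁) n), ← singularCohomology.map_comp,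
    fstVert_comp_secVert, singularCohomology.map_id, ModuleCat.id_apply]

/-- **The restriction `Hⁿ(U × Y) → Hⁿ(U × Y₁)` is surjective** (every class of `U × Y₁ ≃ U` is
pulled back from `U`, hence from `U × Y`). [cite: HatcherAT2002, §3.1 p. 201] -/
theorem map_subsetIncl_vert_surjective (n : ℕ) :
    Function.Surjective (singularCohomology.map R M (subsetIncl (vert U Y₁)) n) := by
  intro a
  obtain ⟨b, rfl⟩ := (map_fstVert_bijective R M (U := U) (Y₁ := Y₁) n).2 a
  refine ⟨singularCohomology.map R M ContinuousMap.fst n b, ?_⟩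
  rw [← ModuleCat.comp_apply, ← singularCohomology.map_comp, fst_comp_subsetIncl_vert]

/-- **The coboundary of the pair `(U × Y, U × Y₁)` vanishes.** [cite: HatcherAT2002, §3.1 p. 200] -/
theorem δ_vert_eq_zero (i j : ℕ) (hij : i + 1 = j) :
    relSingularCohomology.δ R M (U × Y) (vert U Y₁) i j hij = 0 := by
  ext a
  obtain ⟨x, rfl⟩ := map_subsetIncl_vert_surjective R M (U := U) (Y₁ := Y₁) i a
  rw [← ModuleCat.comp_apply, map_subsetIncl_comp_δ]
  rfl

/-- **`Hⁿ(U × Y, U × Y₁) → Hⁿ(U × Y)` is injective** for contractible `Y₁`. [cite: HatcherAT2002, §3.1 p. 200] -/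
theorem toAbsolute_vert_injective (n : ℕ) :
    Function.Injective (relSingularCohomology.toAbsolute R M (U × Y) (vert U Y₁) n) := by
  cases n with
  | zero => exact toAbsolute_zero_injective R M (vert U Y₁)
  | succ i =>
    rw [injective_iff_map_eq_zero]
    intro r hr
    have ex := relSingularCohomology.exact_δ_toAbsolute (R := R) (M := M) (X := U × Y) (vert U Y₁) i (i + 1) rfl
    rw [ShortComplex.moduleCat_exact_iff] at ex
    obtain ⟨a, ha⟩ := ex r hr
    rw [← ha]
    change relSingularCohomology.δ R M (U × Y) (vert U Y₁) i (i + 1) rfl a = 0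
    rw [δ_vert_eq_zero]
    rfl

omit [ContractibleSpace ↥Y₁] in
/-- `s^* x = s_v^*(x|_{U × Y₁})` for the slice `s` through `y₁ ∈ Y₁` and its corestriction `s_v`.
[folklore] -/
theorem map_sliceAt_eq_map_secVert_map {y₁ : Y} (hy₁ : y₁ ∈ Y₁) (n : ℕ) (x : singularCohomology R M (U × Y) n) :
    singularCohomology.map R M (sliceAt (U := U) y₁) n x =
      singularCohomology.map R M (secVert U hy₁) n (singularCohomology.map R M (subsetIncl (vert U Y₁)) n x) := by
  rw [← ModuleCat.comp_apply, ← singularCohomology.map_comp]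
  rfl

omit [ContractibleSpace ↥Y₁] in
/-- `(x|_{U × Y₁})` of a class pulled back from `U` is pulled back along `U × Y₁ → U`. [folklore] -/
theorem map_subsetIncl_map_fst (n : ℕ) (y : singularCohomology R M U n) :
    singularCohomology.map R M (subsetIncl (vert U Y₁)) n (singularCohomology.map R M (ContinuousMap.fst : C(U × Y, U)) n y) =
      singularCohomology.map R M (fstVert U Y₁) n y := by
  rw [← ModuleCat.comp_apply, ← singularCohomology.map_comp]
  rfl

omit [ContractibleSpace ↥Y₁] in
/-- `s^* ∘ (Hⁿ(U × Y, U × Y₁) → Hⁿ(U × Y)) = 0` for a slice `s` through a point of `Y₁`.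
[cite: HatcherAT2002, §3.1 p. 200] -/
theorem map_sliceAt_toAbsolute {y₁ : Y} (hy₁ : y₁ ∈ Y₁) (n : ℕ)
    (r : relSingularCohomology R M (U × Y) (vert U Y₁) n) :
    singularCohomology.map R M (sliceAt (U := U) y₁) n (relSingularCohomology.toAbsolute R M (U × Y) (vert U Y₁) n r) = 0 := by
  rw [map_sliceAt_eq_map_secVert_map R M hy₁, ← ModuleCat.comp_apply
    (relSingularCohomology.toAbsolute R M (U × Y) (vert U Y₁) n), toAbsolute_comp_map_subsetIncl]
  simp

/-- **`x - pr₁^*(s^* x)` comes from `Hⁿ(U × Y, U × Y₁)`** (it restricts to zero on `U × Y₁`).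
[cite: HatcherAT2002, §3.1 p. 200] -/
theorem exists_toAbsolute_eq_sub {y₁ : Y} (hy₁ : y₁ ∈ Y₁) (n : ℕ) (x : singularCohomology R M (U × Y) n) :
    ∃ r : relSingularCohomology R M (U × Y) (vert U Y₁) n,
      relSingularCohomology.toAbsolute R M (U × Y) (vert U Y₁) n r =
        x - singularCohomology.map R M ContinuousMap.fst n (singularCohomology.map R M (sliceAt y₁) n x) := by
  have ex := relSingularCohomology.exact_toAbsolute_map (R := R) (M := M) (X := U × Y) (vert U Y₁) n
  rw [ShortComplex.moduleCat_exact_iff] at ex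
  refine ex _ ?_
  change singularCohomology.map R M (subsetIncl (vert U Y₁)) n (x - _) = 0
  rw [map_sub, map_subsetIncl_map_fst, map_sliceAt_eq_map_secVert_map R M hy₁, map_fstVert_map_secVert,
    sub_self]

/-- **`Hⁿ(U × Y) = Hⁿ(U × Y, U × Y₁) ⊕ pr₁^* Hⁿ(U)`** for contractible `Y₁`: the map
`(r, y) ↦ j(r) + pr₁^* y` is bijective. [cite: HatcherAT2002, §3.1 p. 200] -/
theorem toAbsolute_add_map_fst_bijective (n : ℕ) :
    Function.Bijective (fun p : relSingularCohomology R M (U × Y) (vert U Y₁) n × singularCohomology R M U n =>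
      relSingularCohomology.toAbsolute R M (U × Y) (vert U Y₁) n p.1 +
        singularCohomology.map R M (ContinuousMap.fst : C(U × Y, U)) n p.2) := by
  obtain ⟨⟨y₁, hy₁⟩⟩ := (inferInstance : Nonempty ↥Y₁)
  have hsj : ∀ r, singularCohomology.map R M (sliceAt (U := U) y₁) n
      (relSingularCohomology.toAbsolute R M (U × Y) (vert U Y₁) n r) = 0 :=
    map_sliceAt_toAbsolute R M hy₁ n
  constructor
  · rintro ⟨r, y⟩ ⟨r', y'⟩ h
    dsimp only at h
    have hy : y = y' := by
      have := congrArg (singularCohomology.map R M (sliceAt (U := U) y₁) n) h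
      rwa [map_add, map_add, hsj, hsj, map_sliceAt_map_fst, map_sliceAt_map_fst, zero_add,
        zero_add] at this
    subst hy
    exact Prod.ext (toAbsolute_vert_injective R M n (add_right_cancel h)) rfl
  · intro x
    obtain ⟨r, hr⟩ := exists_toAbsolute_eq_sub R M hy₁ n x
    exact ⟨(r, singularCohomology.map R M (sliceAt (U := U) y₁) n x), by dsimp only; rw [hr, sub_add_cancel]⟩

end SplitOff

/-! ### Excision to the pair `(U × Y₂, U × (Y₁ ∩ Y₂))` -/

section Excision

variable {Y₁ Y₂ : Set Y}

variable (Y₁ Y₂) in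
/-- The excision map `Hⁿ(U × Y, U × Y₁) ⟶ Hⁿ(U × Y₂, U × (Y₁ ∩ Y₂))` (restriction to the subspace
`↥(U × Y₂)`). [cite: HatcherAT2002, §3.1 p. 201] -/
abbrev excMap (n : ℕ) :
    relSingularCohomology R M (U × Y) (vert U Y₁) n ⟶ relSingularCohomology R M ↥(vert U Y₂) (inter U Y₁ Y₂) n :=
  relSingularCohomology.map R M (subsetIncl (vert U Y₂)) (Set.mapsTo_preimage Subtype.val (vert U Y₁)) n

/-- **Excision**: for `Y₁`, `Y₂` open and covering, `Hⁿ(U × Y, U × Y₁) ≅ Hⁿ(U × Y₂, U × (Y₁ ∩ Y₂))`.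
[cite: HatcherAT2002, §3.1 p. 201] -/
theorem isIso_excMap (h₁ : IsOpen Y₁) (h₂ : IsOpen Y₂) (hcov : Y₁ ∪ Y₂ = univ) (n : ℕ) :
    IsIso (excMap R M (U := U) Y₁ Y₂ n) := by
  apply relSingularCohomology.isIso_map_subsetIncl_of_interior
  rw [(isOpen_vert h₁).interior_eq, (isOpen_vert h₂).interior_eq, ← Set.preimage_union, hcov,
    Set.preimage_univ]

/-- `exc⁻¹ (exc r) = r`. [folklore] -/
theorem inv_excMap_apply_excMap (n : ℕ) [IsIso (excMap R M (U := U) Y₁ Y₂ n)]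
    (r : relSingularCohomology R M (U × Y) (vert U Y₁) n) :
    inv (excMap R M Y₁ Y₂ n) (excMap R M Y₁ Y₂ n r) = r := by
  rw [← ModuleCat.comp_apply, IsIso.hom_inv_id]
  rfl

/-- `exc (exc⁻¹ r) = r`. [folklore] -/
theorem excMap_apply_inv_excMap (n : ℕ) [IsIso (excMap R M (U := U) Y₁ Y₂ n)]
    (r : relSingularCohomology R M ↥(vert U Y₂) (inter U Y₁ Y₂) n) :
    excMap R M Y₁ Y₂ n (inv (excMap R M Y₁ Y₂ n) r) = r := by
  rw [← ModuleCat.comp_apply, IsIso.inv_hom_id]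
  rfl

/-- `exc⁻¹ r = 0 ↔ r = 0`. [folklore] -/
theorem inv_excMap_eq_zero_iff (n : ℕ) [IsIso (excMap R M (U := U) Y₁ Y₂ n)]
    (r : relSingularCohomology R M ↥(vert U Y₂) (inter U Y₁ Y₂) n) :
    inv (excMap R M Y₁ Y₂ n) r = 0 ↔ r = 0 := by
  constructor
  · intro h
    rw [← excMap_apply_inv_excMap R M n r, h, map_zero]
  · rintro rfl
    rw [map_zero]

end Excision

/-! ### The pair `(U × Y₂, U × (Y₁ ∩ Y₂))` with `Y₂` contractible and `Y₁ ∩ Y₂ ≠ ∅` -/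

section SmallPair

variable {Y₁ Y₂ : Set Y}

/-- The kernel of the coboundary `δ : Hⁱ(U × Z) → Hⁱ⁺¹(U × Y₂, U × Z)` (`Z = Y₁ ∩ Y₂`) is the image
of the restriction from `U × Y₂` (exactness). [cite: HatcherAT2002, §3.1 p. 200] -/
theorem δ_inter_eq_zero_iff_mem_range (i j : ℕ) (hij : i + 1 = j) (a : singularCohomology R M ↥(inter U Y₁ Y₂) i) :
    relSingularCohomology.δ R M ↥(vert U Y₂) (inter U Y₁ Y₂) i j hij a = 0 ↔
      a ∈ LinearMap.range (singularCohomology.map R M (subsetIncl (inter U Y₁ Y₂)) i).hom := by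
  have ex := relSingularCohomology.exact_map_δ (R := R) (M := M) (X := ↥(vert U Y₂)) (inter U Y₁ Y₂) i j hij
  rw [ShortComplex.moduleCat_exact_iff] at ex
  constructor
  · intro h
    obtain ⟨x, hx⟩ := ex a h
    exact ⟨x, hx⟩
  · rintro ⟨x, rfl⟩
    change (singularCohomology.map R M (subsetIncl (inter U Y₁ Y₂)) i ≫
      relSingularCohomology.δ R M ↥(vert U Y₂) (inter U Y₁ Y₂) i j hij) x = 0
    rw [map_subsetIncl_comp_δ]
    rfl

variable [ContractibleSpace ↥Y₂]

/-- For contractible `Y₂`, the classes of `U × Z` restricted from `U × Y₂` are those pulled back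
from `U`. [cite: HatcherAT2002, §3.1 p. 201] -/
theorem range_map_subsetIncl_inter (i : ℕ) :
    LinearMap.range (singularCohomology.map R M (subsetIncl (inter U Y₁ Y₂)) i).hom =
      LinearMap.range (singularCohomology.map R M (fstInter U Y₁ Y₂) i).hom := by
  have key : ∀ y : singularCohomology R M U i,
      singularCohomology.map R M (subsetIncl (inter U Y₁ Y₂)) i (singularCohomology.map R M (fstVert U Y₂) i y) =
        singularCohomology.map R M (fstInter U Y₁ Y₂) i y := fun y => by
    rw [← ModuleCat.comp_apply, ← singularCohomology.map_comp]
    rfl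
  apply le_antisymm
  · rintro _ ⟨x, rfl⟩
    obtain ⟨y, rfl⟩ := (map_fstVert_bijective R M (U := U) (Y₁ := Y₂) i).2 x
    exact ⟨y, (key y).symm⟩
  · rintro _ ⟨y, rfl⟩
    exact ⟨singularCohomology.map R M (fstVert U Y₂) i y, key y⟩

variable {z₀ : Y} (hz₀ : z₀ ∈ Y₁ ∩ Y₂)
include hz₀

/-- **The restriction `Hⁿ(U × Y₂) → Hⁿ(U × Z)` is injective** (`Z = Y₁ ∩ Y₂ ∋ z₀`; the slice
through `z₀` splits it). [cite: HatcherAT2002, §3.1 p. 201] -/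
theorem map_subsetIncl_inter_injective (n : ℕ) :
    Function.Injective (singularCohomology.map R M (subsetIncl (inter U Y₁ Y₂)) n) := by
  intro a b hab
  have := congrArg (singularCohomology.map R M (secInter U hz₀) n) hab
  rw [← ModuleCat.comp_apply, ← ModuleCat.comp_apply, ← singularCohomology.map_comp,
    subsetIncl_comp_secInter] at this
  exact (map_secVert_bijective R M (U := U) hz₀.2 n).1 this

/-- Hence `Hⁿ(U × Y₂, U × Z) → Hⁿ(U × Y₂)` vanishes. [cite: HatcherAT2002, §3.1 p. 200] -/
theorem toAbsolute_inter_eq_zero (n : ℕ) :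
    relSingularCohomology.toAbsolute R M ↥(vert U Y₂) (inter U Y₁ Y₂) n = 0 := by
  ext r
  apply map_subsetIncl_inter_injective R M hz₀ n
  change (relSingularCohomology.toAbsolute R M ↥(vert U Y₂) (inter U Y₁ Y₂) n ≫
    singularCohomology.map R M (subsetIncl (inter U Y₁ Y₂)) n) r = _
  rw [toAbsolute_comp_map_subsetIncl]
  simp

/-- **The coboundary `δ : Hⁱ(U × Z) → Hⁱ⁺¹(U × Y₂, U × Z)` is surjective.** [cite: HatcherAT2002, §3.1 p. 200] -/
theorem δ_inter_surjective (i j : ℕ) (hij : i + 1 = j) :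
    Function.Surjective (relSingularCohomology.δ R M ↥(vert U Y₂) (inter U Y₁ Y₂) i j hij) := by
  intro r
  have ex := relSingularCohomology.exact_δ_toAbsolute (R := R) (M := M) (X := ↥(vert U Y₂)) (inter U Y₁ Y₂) i j hij
  rw [ShortComplex.moduleCat_exact_iff] at ex
  refine ex r ?_
  change relSingularCohomology.toAbsolute R M ↥(vert U Y₂) (inter U Y₁ Y₂) j r = 0
  rw [toAbsolute_inter_eq_zero R M hz₀]
  rfl

/-- `H⁰(U × Y₂, U × Z) = 0`. [cite: HatcherAT2002, §3.1 p. 200] -/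
theorem relSingularCohomology_inter_zero_eq_zero (r : relSingularCohomology R M ↥(vert U Y₂) (inter U Y₁ Y₂) 0) :
    r = 0 :=
  toAbsolute_zero_injective R M (inter U Y₁ Y₂) (by rw [toAbsolute_inter_eq_zero R M hz₀]; simp)

end SmallPair

/-! ### The decomposition `Hⁱ⁺¹(U × Y) = pr₁^* Hⁱ⁺¹(U) ⊕ κ(Hⁱ(U × Z))` and its naturality -/

section Kappa

variable {Y₁ Y₂ : Set Y} (h₁ : IsOpen Y₁) (h₂ : IsOpen Y₂) (hcov : Y₁ ∪ Y₂ = univ)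

/-- **`κ = j ∘ exc⁻¹ ∘ δ : Hⁱ(U × Z) → Hⁱ⁺¹(U × Y)`** (`Z = Y₁ ∩ Y₂`; coboundary of the pair
`(U × Y₂, U × Z)`, inverse excision to `(U × Y, U × Y₁)`, then forget the pair).
[cite: HatcherAT2002, §3.1 pp. 200–201] -/
def twoPieceKappa (i : ℕ) :
    singularCohomology R M ↥(inter U Y₁ Y₂) i ⟶ singularCohomology R M (U × Y) (i + 1) :=
  haveI := isIso_excMap R M (U := U) h₁ h₂ hcov (i + 1)
  relSingularCohomology.δ R M ↥(vert U Y₂) (inter U Y₁ Y₂) i (i + 1) rfl ≫ inv (excMap R M Y₁ Y₂ (i + 1)) ≫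
    relSingularCohomology.toAbsolute R M (U × Y) (vert U Y₁) (i + 1)

/-- `κ a = j (exc⁻¹ (δ a))`. [folklore] -/
theorem twoPieceKappa_apply (i : ℕ) (a : singularCohomology R M ↥(inter U Y₁ Y₂) i) :
    haveI := isIso_excMap R M (U := U) h₁ h₂ hcov (i + 1)
    twoPieceKappa R M h₁ h₂ hcov i a = relSingularCohomology.toAbsolute R M (U × Y) (vert U Y₁) (i + 1)
      (inv (excMap R M Y₁ Y₂ (i + 1)) (relSingularCohomology.δ R M ↥(vert U Y₂) (inter U Y₁ Y₂) i (i + 1) rfl a)) :=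
  rfl

/-- `s^* ∘ κ = 0` for a slice through a point of `Y₁`. [cite: HatcherAT2002, §3.1 p. 200] -/
theorem map_sliceAt_twoPieceKappa {y₁ : Y} (hy₁ : y₁ ∈ Y₁) (i : ℕ) (a : singularCohomology R M ↥(inter U Y₁ Y₂) i) :
    singularCohomology.map R M (sliceAt (U := U) y₁) (i + 1) (twoPieceKappa R M h₁ h₂ hcov i a) = 0 :=
  map_sliceAt_toAbsolute R M hy₁ (i + 1) _

variable [ContractibleSpace ↥Y₁]

/-- **Uniqueness of the decomposition**: `pr₁^* y + κ a = pr₁^* y' + κ a'` forces `y = y'` (apply a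
slice) and `κ a = κ a'`. [cite: HatcherAT2002, §3.1 pp. 200–201] -/
theorem eq_of_map_fst_add_twoPieceKappa_eq (i : ℕ) {y y' : singularCohomology R M U (i + 1)}
    {a a' : singularCohomology R M ↥(inter U Y₁ Y₂) i}
    (h : singularCohomology.map R M (ContinuousMap.fst : C(U × Y, U)) (i + 1) y + twoPieceKappa R M h₁ h₂ hcov i a =
      singularCohomology.map R M (ContinuousMap.fst : C(U × Y, U)) (i + 1) y' + twoPieceKappa R M h₁ h₂ hcov i a') :
    y = y' ∧ twoPieceKappa R M h₁ h₂ hcov i a = twoPieceKappa R M h₁ h₂ hcov i a' := by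
  obtain ⟨⟨y₁, hy₁⟩⟩ := (inferInstance : Nonempty ↥Y₁)
  have hy : y = y' := by
    have := congrArg (singularCohomology.map R M (sliceAt (U := U) y₁) (i + 1)) h
    rwa [map_add, map_add, map_sliceAt_twoPieceKappa R M h₁ h₂ hcov hy₁,
      map_sliceAt_twoPieceKappa R M h₁ h₂ hcov hy₁, map_sliceAt_map_fst, map_sliceAt_map_fst, add_zero,
      add_zero] at this
  subst hy
  exact ⟨rfl, add_left_cancel h⟩

/-- **`κ a = 0` iff `a` is pulled back from `U`** (injectivity of `Hⁱ⁺¹(U × Y, U × Y₁) → Hⁱ⁺¹(U × Y)`,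
excision, and `ker δ = im(Hⁱ(U × Y₂) → Hⁱ(U × Z)) = pr₁^* Hⁱ(U)` for contractible `Y₂`).
[cite: HatcherAT2002, §3.1 pp. 200–201] -/
theorem twoPieceKappa_eq_zero_iff [ContractibleSpace ↥Y₂] (i : ℕ) (a : singularCohomology R M ↥(inter U Y₁ Y₂) i) :
    twoPieceKappa R M h₁ h₂ hcov i a = 0 ↔
      a ∈ LinearMap.range (singularCohomology.map R M (fstInter U Y₁ Y₂) i).hom := by
  haveI := isIso_excMap R M (U := U) h₁ h₂ hcov (i + 1)
  rw [← range_map_subsetIncl_inter R M, ← δ_inter_eq_zero_iff_mem_range R M i (i + 1) rfl, twoPieceKappa_apply,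
    ← inv_excMap_eq_zero_iff R M (i + 1)]
  constructor
  · intro h
    exact toAbsolute_vert_injective R M (U := U) (Y₁ := Y₁) (i + 1) (h.trans (map_zero _).symm)
  · intro h
    rw [h, map_zero]

variable [ContractibleSpace ↥Y₂] {z₀ : Y} (hz₀ : z₀ ∈ Y₁ ∩ Y₂)
include hz₀

/-- **Existence of the decomposition**: every `x ∈ Hⁱ⁺¹(U × Y)` is `pr₁^*(s^* x) + κ a` for some
`a ∈ Hⁱ(U × Z)` (`s` any slice through `Y₁`). [cite: HatcherAT2002, §3.1 pp. 200–201] -/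
theorem exists_eq_map_fst_add_twoPieceKappa {y₁ : Y} (hy₁ : y₁ ∈ Y₁) (i : ℕ)
    (x : singularCohomology R M (U × Y) (i + 1)) :
    ∃ a : singularCohomology R M ↥(inter U Y₁ Y₂) i,
      x = singularCohomology.map R M (ContinuousMap.fst : C(U × Y, U)) (i + 1)
            (singularCohomology.map R M (sliceAt y₁) (i + 1) x) + twoPieceKappa R M h₁ h₂ hcov i a := by
  haveI := isIso_excMap R M (U := U) h₁ h₂ hcov (i + 1)
  obtain ⟨r, hr⟩ := exists_toAbsolute_eq_sub R M hy₁ (i + 1) x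
  obtain ⟨a, ha⟩ := δ_inter_surjective R M hz₀ i (i + 1) rfl (excMap R M Y₁ Y₂ (i + 1) r)
  refine ⟨a, ?_⟩
  have hκ : twoPieceKappa R M h₁ h₂ hcov i a = relSingularCohomology.toAbsolute R M (U × Y) (vert U Y₁) (i + 1) r := by
    rw [twoPieceKappa_apply, ha, inv_excMap_apply_excMap]
  rw [hκ, hr]
  exact (add_sub_cancel _ x).symm

include h₁ h₂ hcov in
/-- **`pr₁^* : H⁰(U) → H⁰(U × Y)` is bijective** (`H⁰(U × Y, U × Y₁) ≅ H⁰(U × Y₂, U × Z) = 0`).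
[cite: HatcherAT2002, §3.1 pp. 200–201] -/
theorem map_fst_bijective_zero :
    Function.Bijective (singularCohomology.map R M (ContinuousMap.fst : C(U × Y, U)) 0) := by
  haveI := isIso_excMap R M (U := U) h₁ h₂ hcov 0
  obtain ⟨⟨y₁, hy₁⟩⟩ := (inferInstance : Nonempty ↥Y₁)
  refine ⟨(Function.LeftInverse.injective fun y => map_sliceAt_map_fst R M (C := Y) y₁ 0 y), fun x => ?_⟩
  obtain ⟨r, hr⟩ := exists_toAbsolute_eq_sub R M hy₁ 0 x
  have hr0 : r = 0 := by
    have h0 : excMap R M Y₁ Y₂ 0 r = 0 := relSingularCohomology_inter_zero_eq_zero R M hz₀ _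
    rw [← inv_excMap_apply_excMap R M (Y₂ := Y₂) 0 r, h0, map_zero]
  rw [hr0, map_zero, eq_comm, sub_eq_zero] at hr
  exact ⟨_, hr.symm⟩

end Kappa

/-! ### Naturality in `U` -/

section Naturality

variable {Y₁ Y₂ : Set Y} (h₁ : IsOpen Y₁) (h₂ : IsOpen Y₂) (hcov : Y₁ ∪ Y₂ = univ) (g : C(U', U))

/-- `g × 𝟙 : U' × Y → U × Y`. [folklore] -/
abbrev prodMapId (g : C(U', U)) : C(U' × Y, U × Y) := g.prodMap (ContinuousMap.id Y)

/-- `g × 𝟙` maps `U' × S` into `U × S`. [folklore] -/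
theorem mapsTo_prodMapId_vert (S : Set Y) : Set.MapsTo (prodMapId (Y := Y) g) (vert U' S) (vert U S) :=
  fun _ hp => hp

/-- `g × 𝟙` restricted to `U' × Y₂ → U × Y₂`. [folklore] -/
abbrev prodMapIdVert (g : C(U', U)) (Y₂ : Set Y) : C(↥(vert U' Y₂), ↥(vert U Y₂)) :=
  relSingularCohomology.restrictPair (prodMapId g) (mapsTo_prodMapId_vert g Y₂)

/-- `(g × 𝟙)|_{U' × Y₂}` maps `U' × Z` into `U × Z`. [folklore] -/
theorem mapsTo_prodMapIdVert_inter :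
    Set.MapsTo (prodMapIdVert g Y₂) (inter U' Y₁ Y₂) (inter U Y₁ Y₂) := fun _ hp => hp

/-- `g × 𝟙` restricted to `U' × Z → U × Z`, `Z = Y₁ ∩ Y₂`. [folklore] -/
abbrev prodMapIdInter (g : C(U', U)) (Y₁ Y₂ : Set Y) : C(↥(inter U' Y₁ Y₂), ↥(inter U Y₁ Y₂)) :=
  relSingularCohomology.restrictPair (prodMapIdVert g Y₂) (mapsTo_prodMapIdVert_inter (Y₁ := Y₁) g)

/-- `(g × 𝟙)|_{U' × Z}` in the coordinates `U × ↥Z`: it is `g × 𝟙`. [folklore] -/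
theorem interHomeomorph_comp_prodMapIdInter :
    (interHomeomorph U Y₁ Y₂ : C(↥(inter U Y₁ Y₂), U × ↥(Y₁ ∩ Y₂))).comp (prodMapIdInter g Y₁ Y₂) =
      (g.prodMap (ContinuousMap.id ↥(Y₁ ∩ Y₂))).comp (interHomeomorph U' Y₁ Y₂ : C(↥(inter U' Y₁ Y₂), _)) :=
  rfl

/-- The excision maps commute with `g × 𝟙`. [folklore] -/
theorem map_prodMapId_comp_excMap (n : ℕ) :
    relSingularCohomology.map R M (prodMapId g) (mapsTo_prodMapId_vert g Y₁) n ≫ excMap R M (U := U') Y₁ Y₂ n =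
      excMap R M (U := U) Y₁ Y₂ n ≫
        relSingularCohomology.map R M (prodMapIdVert g Y₂) (mapsTo_prodMapIdVert_inter (Y₁ := Y₁) g) n := by
  rw [excMap, excMap, ← relSingularCohomology.map_comp, ← relSingularCohomology.map_comp]
  rfl

/-- **Naturality of `κ` in `U`**: `(g × 𝟙)^* (κ_U a) = κ_{U'} (((g × 𝟙)|_{U' × Z})^* a)`.
[cite: HatcherAT2002, §3.1 p. 200] -/
theorem map_prodMapId_twoPieceKappa (i : ℕ) (a : singularCohomology R M ↥(inter U Y₁ Y₂) i) :
    singularCohomology.map R M (prodMapId g) (i + 1) (twoPieceKappa R M (U := U) h₁ h₂ hcov i a) =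
      twoPieceKappa R M (U := U') h₁ h₂ hcov i (singularCohomology.map R M (prodMapIdInter g Y₁ Y₂) i a) := by
  haveI := isIso_excMap R M (U := U) h₁ h₂ hcov (i + 1)
  haveI := isIso_excMap R M (U := U') h₁ h₂ hcov (i + 1)
  rw [twoPieceKappa_apply, twoPieceKappa_apply]
  -- move `(g × 𝟙)^*` past `toAbsolute`
  rw [← ModuleCat.comp_apply, ← relSingularCohomology.map_comp_toAbsolute (prodMapId g) (mapsTo_prodMapId_vert g Y₁),
    ModuleCat.comp_apply]
  congr 1
  -- past the inverse excision: compare after applying the excision isomorphism of `U'`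
  have hinj : Function.Injective (excMap R M (U := U') Y₁ Y₂ (i + 1)) := fun r r' hrr' => by
    rw [← inv_excMap_apply_excMap R M (Y₂ := Y₂) (i + 1) r, hrr', inv_excMap_apply_excMap]
  apply hinj
  rw [excMap_apply_inv_excMap, ← ModuleCat.comp_apply, map_prodMapId_comp_excMap, ModuleCat.comp_apply,
    excMap_apply_inv_excMap]
  -- past the coboundary
  rw [← ModuleCat.comp_apply, relSingularCohomology.δ_comp_map (prodMapIdVert g Y₂)
    (mapsTo_prodMapIdVert_inter (Y₁ := Y₁) g) i (i + 1) rfl, ModuleCat.comp_apply]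

/-- Naturality of `κ`, composition form. [cite: HatcherAT2002, §3.1 p. 200] -/
theorem twoPieceKappa_comp_map_prodMapId (i : ℕ) :
    twoPieceKappa R M (U := U) h₁ h₂ hcov i ≫ singularCohomology.map R M (prodMapId g) (i + 1) =
      singularCohomology.map R M (prodMapIdInter g Y₁ Y₂) i ≫ twoPieceKappa R M (U := U') h₁ h₂ hcov i := by
  ext a
  exact map_prodMapId_twoPieceKappa R M h₁ h₂ hcov g i a

end Naturality

end Literature.AlgebraicTopology.SingularHomology
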